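import Summits.QuantumFields.BalabanUV.Beta.D1BFx.LamDictionary

/-!
# `BalabanUV.Beta.D1BFx.LamPartnerLetters` — road «BF-x» for binder row D1, slot (K), census group **G_Λ**: THE COVARIANCE AND LOCALISATION LETTERS
# (an3-g53 §6 (C), (D)) OF THE TWO PARTNER FUNCTIONALS `LamDictionary.Nrν`∕`Nrμ` — the letters `hcov•`∕`hNr•` that both the Λ-dictionary
# `LamDictionary.gLam_row_eq_lamWords` (BRICK 2b) and its consumer `LamRowGlue.gLam_row_eq_zero_of_dict` display (owner «LAM-DICT», ruling ρ-g9-18; BRICK 2c)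

HONEST DEPENDENCY (page 1, mandatory): continuum YM on T⁴ ⇐ BetaPertH ∧ nine spine estimates (0/9 proved); BetaPertH ⇐ (D1) ∧ (D4) ∧
CAP+tail; G-an2-4 gates asym, D1 and NE2/3/4.  HONEST FRAMING (cell contract, verbatim): «discharging `BetaPertH` makes Bałaban's UV
stability UNCONDITIONAL — a real constructive-QFT result; it is NOT the continuum limit and NOT the Clay problem.»  THIS MODULE DISCHARGES
NOTHING of the wall: [folklore] kernel bookkeeping BY NAME — block covariance from `FineStencilBFBalaban.SbfBal_translate_block`,
`AveragingHessianKernels.hessFF_translate`, `GluonLeg.shiftK_Ga_neg`, `ExpKernelCalculus.bubble_shiftK`∕`tadpole_shiftK`; exponential localisation from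
`ExpKernelCalculus.biLoc_comp_decays`∕`biLoc_comp_biLoc`∕`abs_tr_le`∕`abs_tadpole_le`.  No definition, no `Prop` minted, nothing cited, 0 sorry.
The Λ₂-companion's sockets (`hTloc`: localisation with amplitude decaying from the fine bond; `hTcov`: block covariance — an3-g53 §5) stay DISPLAYED
HYPOTHESES (instance = the future `WbfBal`); NO zero-momentum letter is touched.  0 wall binders; (K) NOT closed; NOT D1, NOT `BetaPertH`, NOT
continuum, NOT Clay.

ABSOLUTE RULE (cell charter, verbatim): «No internally-minted statement may enter as a cited fact. Every hypothesis is either kernel-proved in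
this package or a verbatim quotation of a PUBLISHED theorem with page reference. The manuscript(s) under audit are NOT citable for their own
disputed steps — they are the thing under adjudication; programme-internal (2001/route/tribunal) claims are never citable.»

CONTENT ([folklore]; `G := Ga n a`, `Y m y := ffOf (hessFF n m y)`).
* §1 `abs_bubble_le_exp` (a spread leg, two bi-localised vertices at `p`, `q` ⟹ `|bubble| ≤ K·e^{−(δ/4)|p−q|₁}`), `SbfBal_sub_SbL_eq` (`S_full − cΛ•SbL n =` the full stencil
  with its Λ-weight set to `0`), `Y_translate`.
* §2 (C) **`Nrν_cov`**, **`Nrμ_cov`** — `Nr• m (y + t) (u′ + n•t) = Nr• m y u′`, under the Λ₂-companion's covariance socket `hTcov`.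
* §3 (D) **`Nrν_decay`**, **`Nrμ_decay`** — `∃ C′ δ′ > 0, |Nr• m y u| ≤ C′·e^{−δ′·|n•y − u|₁}`, under the Λ₂-companion's localisation socket `hTloc`.
With BRICK 2b these are ALL the partner letters of `LamRowGlue.gLam_row_eq_zero_of_dict` except the two zero-momentum letters `hZero•` ((W1)+(W2′)+
`KernelWardInsertionZero.tsum_resp_eq_zero`, the owner's).  Unit `b2b-balaban-gan24-formalise-leaf-05` (gen 40), G-an2-4 swarm leaf prover on cross-lane kernel
duty for road «BF-x» (owner d1-p2).
-/

noncomputable section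

namespace Summit.QuantumFields.BalabanUV.Beta.D1BFx.LamPartnerLetters

open Finset
open scoped BigOperators
open Literature.MathematicalPhysics.QuantumFieldTheory
open Literature.MathematicalPhysics.QuantumFieldTheory.Balaban1983to89
open Literature.MathematicalPhysics.QuantumFieldTheory.Balaban1983to89.Beta
open B12Sec2to5 (l1 l1_nonneg)
open ExpKernelCalculus (Site MKer Decays BiLoc bubble tadpole comp tr shiftK Zl Zl_nonneg abs_tr_le abs_tadpole_le biLoc_comp_decays biLoc_comp_biLoc
  bubble_shiftK tadpole_shiftK l1_sub_symm)
open OneStepResolventKernel (Fib KInv)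
open AveragingHessianKernels (hessFF biLoc_hessFF hessFF_translate)
open Summit.QuantumFields.BalabanUV.Beta.TameKernelCalculus (Spr biLoc_of_le decays_of_le)
open Summit.QuantumFields.BalabanUV.Beta.D1BFx.FineStencilBF (ffOf biLoc_ffOf ffOf_shiftK)
open Summit.QuantumFields.BalabanUV.Beta.D1BFx.GluonLeg (Ga shiftK_Ga_neg)
open Summit.QuantumFields.BalabanUV.Beta.D1BFx.DressedBubbleBridge (biLoc_const_mono)
open Summit.QuantumFields.BalabanUV.Beta.D1BFx.FineStencilBFBalaban (SbfBal exists_biLoc_SbfBal SbfBal_translate_block)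
open Summit.QuantumFields.BalabanUV.Beta.D1BFx.GluonKernelSectors (SbL SbfBal_eq_secSum secWt_zero secWt_one secWt_two secSt_zero secSt_one secSt_two)
open Summit.QuantumFields.BalabanUV.Beta.D1BFx.LamDictionary (Nrν Nrμ)

/-! ## §1 Plumbing -/

section Plumbing

variable {D : ℕ} {F : Type*} [Fintype F] [DecidableEq F] [Nonempty F]

omit [DecidableEq F] in
/-- [folklore] **A BUBBLE OF TWO LOCALISED VERTICES IS EXPONENTIALLY SMALL IN THEIR DISTANCE**: decaying leg `A` (rate `δ`), `V` bi-localised at `p`,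
`W` at `q`, same rate ⟹ `|bubble A V W| ≤ K·e^{−(δ/4)·|p − q|₁}` with `K` depending on the constants only. -/
theorem abs_bubble_le_exp {A V W : MKer D F} {C Cv Cw δ : ℝ} (hA : Decays A C δ) {p q : Site D} (hV : BiLoc V p p Cv δ)
    (hW : BiLoc W q q Cw δ) (hδ : 0 < δ) :
    |bubble A V W| ≤ (Fintype.card F : ℝ) * ((Fintype.card F : ℝ) * (((Fintype.card F : ℝ) * (C * Cv) * Zl D (δ - δ / 2)) *
        ((Fintype.card F : ℝ) * (C * Cw) * Zl D (δ - δ / 2))) * Zl D (δ / 2 / 2)) * Zl D (δ / 2 / 2) *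
      Real.exp (-(δ / 2 / 2) * l1 (p - q)) := by
  obtain ⟨a₀⟩ := (inferInstance : Nonempty F)
  have hδ2 : 0 < δ / 2 := half_pos hδ
  have h1 : BiLoc (comp A V) p p ((Fintype.card F : ℝ) * (C * Cv) * Zl D (δ - δ / 2)) (δ / 2) :=
    biLoc_comp_decays hA hV hδ2.le (by linarith)
  have h2 : BiLoc (comp A W) q q ((Fintype.card F : ℝ) * (C * Cw) * Zl D (δ - δ / 2)) (δ / 2) :=
    biLoc_comp_decays hA hW hδ2.le (by linarith)
  have hC1 : 0 ≤ (Fintype.card F : ℝ) * (C * Cv) * Zl D (δ - δ / 2) := (h1.nonneg a₀)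
  have hC2 : 0 ≤ (Fintype.card F : ℝ) * (C * Cw) * Zl D (δ - δ / 2) := (h2.nonneg a₀)
  have hC3 : 0 ≤ (Fintype.card F : ℝ) * (((Fintype.card F : ℝ) * (C * Cv) * Zl D (δ - δ / 2)) *
      ((Fintype.card F : ℝ) * (C * Cw) * Zl D (δ - δ / 2))) * Zl D (δ / 2 / 2) :=
    mul_nonneg (mul_nonneg (Nat.cast_nonneg _) (mul_nonneg hC1 hC2)) (Zl_nonneg (by linarith))
  have h3 := biLoc_const_mono (biLoc_comp_biLoc h1 h2 hδ2)
    (mul_le_of_le_one_right hC3 (Real.exp_le_one_iff.2 (by nlinarith [l1_nonneg (p - q)])))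
  unfold ExpKernelCalculus.bubble
  exact abs_tr_le h3 hδ2

end Plumbing

section Letters

variable (n : ℕ) [NeZero n] (a cE cVH cΛ cR cK cQ cΛ₂ ωgl : ℝ) {TΛ : Fin 4 → Site 4 → Fin 4 → Site 4 → MKer 4 (Fin 4)} {CT δT : ℝ}

/-- [folklore] The μ-side partner stencil IS the full stencil with its Λ-weight set to zero: `S_full κ u − cΛ•SbL n κ u = SbfBal n a cE cVH 0 cR cK cQ κ u`
(`GluonKernelSectors.SbfBal_eq_secSum`). -/
theorem SbfBal_sub_SbL_eq (κ : Fin 4) (u : Site 4) :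
    SbfBal n a cE cVH cΛ cR cK cQ κ u - cΛ • SbL n κ u = SbfBal n a cE cVH 0 cR cK cQ κ u := by
  rw [SbfBal_eq_secSum, SbfBal_eq_secSum, Fin.sum_univ_three, Fin.sum_univ_three, secWt_zero, secWt_one, secWt_two, secWt_zero, secWt_one,
    secWt_two, secSt_one, zero_smul]
  abel

omit [NeZero n] in
/-- [folklore] Block covariance of the Λ-companion: `Y m (y + t) = shiftK (−(n•t)) (Y m y)`. -/
theorem Y_translate (m : Fin 4) (y t : Site 4) : ffOf (hessFF n m (y + t)) = shiftK (-((n : ℤ) • t)) (ffOf (hessFF n m y)) := by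
  rw [hessFF_translate (L := n) m y t, ffOf_shiftK]

/-! ## §2 (C) Block covariance of the partner functionals -/

/-- [folklore] **(C) FOR `Nrν`**: `Nrν m (y + t) (u′ + n•t) = Nrν m y u′` (`0 < a`; the Λ₂-companion's covariance socket `hTcov`). -/
theorem Nrν_cov (ha : 0 < a) (hTcov : ∀ m y κ u t, TΛ m (y + t) κ (u + (n : ℤ) • t) = shiftK (-((n : ℤ) • t)) (TΛ m y κ u)) (μ : Fin 4)
    (m : Fin 4) (y t u' : Site 4) :
    Nrν n a cE cVH cΛ cR cK cQ cΛ₂ ωgl TΛ μ m (y + t) (u' + (n : ℤ) • t) = Nrν n a cE cVH cΛ cR cK cQ cΛ₂ ωgl TΛ μ m y u' := by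
  have hn : 1 ≤ n := NeZero.one_le
  simp only [Nrν, SbfBal_sub_SbL_eq]
  rw [SbfBal_translate_block n a ha cE cVH 0 cR cK cQ μ u' t, Y_translate, hTcov m y μ u' t]
  conv_lhs => rw [← shiftK_Ga_neg n a hn t]
  rw [bubble_shiftK, tadpole_shiftK]

/-- [folklore] **(C) FOR `Nrμ`**: `Nrμ m (y + t) (u′ + n•t) = Nrμ m y u′`. -/
theorem Nrμ_cov (ha : 0 < a) (hTcov : ∀ m y κ u t, TΛ m (y + t) κ (u + (n : ℤ) • t) = shiftK (-((n : ℤ) • t)) (TΛ m y κ u)) (ν : Fin 4)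
    (m : Fin 4) (y t u' : Site 4) :
    Nrμ n a cE cVH cΛ cR cK cQ cΛ₂ ωgl TΛ ν m (y + t) (u' + (n : ℤ) • t) = Nrμ n a cE cVH cΛ cR cK cQ cΛ₂ ωgl TΛ ν m y u' := by
  have hn : 1 ≤ n := NeZero.one_le
  simp only [Nrμ]
  rw [SbfBal_translate_block n a ha cE cVH cΛ cR cK cQ ν u' t, Y_translate, hTcov m y ν u' t]
  conv_lhs => rw [← shiftK_Ga_neg n a hn t]
  rw [bubble_shiftK, tadpole_shiftK]

/-! ## §3 (D) Exponential localisation of the partner functionals -/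

omit [NeZero n] in
/-- [folklore] A weighted sum of two exponentially localised scalar families is exponentially localised (common rate = the minimum). -/
theorem decay_of_two {B T : Fin 4 → Site 4 → Site 4 → ℝ} {KB δB KT δT' : ℝ} (c₀ c₁ c₂ : ℝ) (hKB : 0 ≤ KB) (hKT : 0 ≤ KT) (hδB : 0 < δB)
    (hδT' : 0 < δT') (hB : ∀ m y u, |B m y u| ≤ KB * Real.exp (-δB * l1 ((n : ℤ) • y - u)))
    (hT : ∀ m y u, |T m y u| ≤ KT * Real.exp (-δT' * l1 ((n : ℤ) • y - u))) :
    ∃ C' δ' : ℝ, 0 < δ' ∧ ∀ (m : Fin 4) (y u : Site 4),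
      |c₀ * (c₁ * B m y u + c₂ * T m y u)| ≤ C' * Real.exp (-δ' * l1 ((n : ℤ) • y - u)) := by
  refine ⟨|c₀| * (|c₁| * KB + |c₂| * KT), min δB δT', lt_min hδB hδT', fun m y u => ?_⟩
  have hl := l1_nonneg ((n : ℤ) • y - u)
  have eB : Real.exp (-δB * l1 ((n : ℤ) • y - u)) ≤ Real.exp (-(min δB δT') * l1 ((n : ℤ) • y - u)) :=
    Real.exp_le_exp.2 (by nlinarith [min_le_left δB δT'])
  have eT : Real.exp (-δT' * l1 ((n : ℤ) • y - u)) ≤ Real.exp (-(min δB δT') * l1 ((n : ℤ) • y - u)) :=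
    Real.exp_le_exp.2 (by nlinarith [min_le_right δB δT'])
  have h1 : |c₁ * B m y u| ≤ |c₁| * KB * Real.exp (-(min δB δT') * l1 ((n : ℤ) • y - u)) := by
    rw [abs_mul, mul_assoc]
    exact mul_le_mul_of_nonneg_left ((hB m y u).trans (mul_le_mul_of_nonneg_left eB hKB)) (abs_nonneg _)
  have h2 : |c₂ * T m y u| ≤ |c₂| * KT * Real.exp (-(min δB δT') * l1 ((n : ℤ) • y - u)) := by
    rw [abs_mul, mul_assoc]
    exact mul_le_mul_of_nonneg_left ((hT m y u).trans (mul_le_mul_of_nonneg_left eT hKT)) (abs_nonneg _)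
  rw [abs_mul]
  calc |c₀| * |c₁ * B m y u + c₂ * T m y u| ≤ |c₀| * (|c₁ * B m y u| + |c₂ * T m y u|) :=
        mul_le_mul_of_nonneg_left (abs_add_le _ _) (abs_nonneg _)
    _ ≤ |c₀| * (|c₁| * KB * Real.exp (-(min δB δT') * l1 ((n : ℤ) • y - u)) + |c₂| * KT * Real.exp (-(min δB δT') * l1 ((n : ℤ) • y - u))) :=
        mul_le_mul_of_nonneg_left (add_le_add h1 h2) (abs_nonneg _)
    _ = |c₀| * (|c₁| * KB + |c₂| * KT) * Real.exp (-(min δB δT') * l1 ((n : ℤ) • y - u)) := by ring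

variable {a}

/-- [folklore] The Λ-companion bubble against a bond-localised stencil family decays exponentially in `|n•y − u|₁` (both slot orders, one constant, one rate). -/
theorem exists_bubble_Y_decay (hGa : Spr (Ga n a)) {S : Fin 4 → Site 4 → MKer 4 (Fin 4)} {Cs δs : ℝ} (hδs : 0 < δs)
    (hS : ∀ κ u, BiLoc (S κ u) u u Cs δs) (κ : Fin 4) :
    ∃ KB δB : ℝ, 0 ≤ KB ∧ 0 < δB ∧ (∀ (m : Fin 4) (y u : Site 4), |bubble (Ga n a) (S κ u) (ffOf (hessFF n m y))| ≤ KB * Real.exp (-δB * l1 ((n : ℤ) • y - u)))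
      ∧ ∀ (m : Fin 4) (y u : Site 4), |bubble (Ga n a) (ffOf (hessFF n m y)) (S κ u)| ≤ KB * Real.exp (-δB * l1 ((n : ℤ) • y - u)) := by
  have hn : 1 ≤ n := NeZero.one_le
  obtain ⟨CA, δA, hδA, hAd⟩ := hGa
  set δ₀ : ℝ := min δA δs with hδ₀def
  have hδ₀ : 0 < δ₀ := lt_min hδA hδs
  have hA : Decays (Ga n a) (|CA|) δ₀ := decays_of_le hAd (min_le_left _ _)
  have hV : ∀ u, BiLoc (S κ u) u u (|Cs|) δ₀ := fun u => biLoc_of_le (hS κ u) (min_le_right _ _)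
  obtain ⟨CY, hY⟩ : ∃ CY : ℝ, ∀ (m : Fin 4) (y : Site 4), BiLoc (ffOf (hessFF n m y)) ((n : ℤ) • y) ((n : ℤ) • y) CY δ₀ :=
    ⟨_, fun m y => biLoc_ffOf (biLoc_hessFF (d := 3) (L := n) hn m y hδ₀.le)⟩
  have hCY : 0 ≤ CY := (hY 0 0).nonneg (0 : Fin 4)
  have hZ1 : 0 ≤ Zl 4 (δ₀ - δ₀ / 2) := Zl_nonneg (by linarith)
  have hZ2 : 0 ≤ Zl 4 (δ₀ / 2 / 2) := Zl_nonneg (by positivity)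
  refine ⟨(Fintype.card (Fin 4) : ℝ) * ((Fintype.card (Fin 4) : ℝ) * (((Fintype.card (Fin 4) : ℝ) * (|CA| * |Cs|) * Zl 4 (δ₀ - δ₀ / 2)) *
      ((Fintype.card (Fin 4) : ℝ) * (|CA| * CY) * Zl 4 (δ₀ - δ₀ / 2))) * Zl 4 (δ₀ / 2 / 2)) * Zl 4 (δ₀ / 2 / 2), δ₀ / 2 / 2,
    by positivity, by positivity, fun m y u => (abs_bubble_le_exp hA (hV u) (hY m y) hδ₀).trans (le_of_eq ?_),
    fun m y u => (abs_bubble_le_exp hA (hY m y) (hV u) hδ₀).trans (le_of_eq ?_)⟩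
  · rw [l1_sub_symm]
  · ring

/-- [folklore] The Λ₂-companion tadpole decays exponentially in `|n•y − u|₁` (the socket's amplitude decay carried through `abs_tadpole_le`). -/
theorem exists_tadpole_T_decay (hGa : Spr (Ga n a)) (hδT : 0 < δT)
    (hTloc : ∀ m y κ u, BiLoc (TΛ m y κ u) ((n : ℤ) • y) ((n : ℤ) • y) (CT * Real.exp (-δT * l1 ((n : ℤ) • y - u))) δT) (κ : Fin 4) :
    ∃ KT δT' : ℝ, 0 ≤ KT ∧ 0 < δT' ∧ ∀ (m : Fin 4) (y u : Site 4),
      |tadpole (Ga n a) (TΛ m y κ u)| ≤ KT * Real.exp (-δT' * l1 ((n : ℤ) • y - u)) := by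
  have hCT : 0 ≤ CT := by
    have h := (hTloc 0 0 0 0).nonneg (0 : Fin 4)
    have hpos : (0 : ℝ) < Real.exp (-δT * l1 ((n : ℤ) • (0 : Site 4) - 0)) := Real.exp_pos _
    nlinarith
  obtain ⟨CA, δA, hδA, hAd⟩ := hGa
  set δ₀ : ℝ := min δA δT with hδ₀def
  have hδ₀ : 0 < δ₀ := lt_min hδA hδT
  have hA : Decays (Ga n a) (|CA|) δ₀ := decays_of_le hAd (min_le_left _ _)
  -- lower the companion's rate to `δ₀`, keeping the decaying amplitude (it is nonnegative)
  have hT : ∀ (m : Fin 4) (y u : Site 4), BiLoc (TΛ m y κ u) ((n : ℤ) • y) ((n : ℤ) • y) (CT * Real.exp (-δT * l1 ((n : ℤ) • y - u))) δ₀ := by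
    intro m y u x z α β
    refine (hTloc m y κ u x z α β).trans (mul_le_mul_of_nonneg_left (Real.exp_le_exp.2 ?_) (by positivity))
    nlinarith [l1_nonneg (x - (n : ℤ) • y), l1_nonneg (z - (n : ℤ) • y), min_le_right δA δT]
  have hZ1 := Zl_nonneg (D := 4) (show 0 < δ₀ - δ₀ / 2 by linarith)
  have hZ2 := Zl_nonneg (D := 4) (show 0 < δ₀ / 2 / 2 by positivity)
  refine ⟨(Fintype.card (Fin 4) : ℝ) * ((Fintype.card (Fin 4) : ℝ) * (|CA| * CT) * Zl 4 (δ₀ - δ₀ / 2)) * Zl 4 (δ₀ / 2 / 2), δT,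
    by positivity, hδT, fun m y u => (abs_tadpole_le hA (hT m y u) hδ₀).trans (le_of_eq ?_)⟩
  rw [sub_self, show l1 (0 : Site 4) = 0 from by simp [l1], mul_zero, Real.exp_zero, mul_one]
  ring

/-- [folklore] **(D) FOR `Nrν`**: `∃ C′, δ′ > 0, |Nrν m y u| ≤ C′·e^{−δ′·|n•y − u|₁}` (`0 < a`, `Spr (Ga n a)`, the Λ₂-companion's localisation socket `hTloc`). -/
theorem Nrν_decay (ha : 0 < a) (hGa : Spr (Ga n a)) (hδT : 0 < δT)
    (hTloc : ∀ m y κ u, BiLoc (TΛ m y κ u) ((n : ℤ) • y) ((n : ℤ) • y) (CT * Real.exp (-δT * l1 ((n : ℤ) • y - u))) δT) (μ : Fin 4) :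
    ∃ C' δ' : ℝ, 0 < δ' ∧ ∀ (m : Fin 4) (y u : Site 4),
      |Nrν n a cE cVH cΛ cR cK cQ cΛ₂ ωgl TΛ μ m y u| ≤ C' * Real.exp (-δ' * l1 ((n : ℤ) • y - u)) := by
  obtain ⟨Cf, δf, hδf, hSf⟩ := exists_biLoc_SbfBal n a ha cE cVH 0 cR cK cQ
  obtain ⟨KB, δB, hKB, hδB, hB, -⟩ := exists_bubble_Y_decay n hGa hδf hSf μ
  obtain ⟨KT, δT', hKT, hδT', hT⟩ := exists_tadpole_T_decay n hGa hδT hTloc μ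
  obtain ⟨C', δ', hδ', h⟩ := decay_of_two n ωgl (((n : ℝ) ^ 8)⁻¹ * (cΛ * (1 / 2 : ℝ))) (((n : ℝ) ^ 8)⁻¹ * (cΛ₂ * (1 / 2 : ℝ)))
    hKB hKT hδB hδT' (fun m y u => hB m y u) (fun m y u => hT m y u)
  refine ⟨C', δ', hδ', fun m y u => ?_⟩
  have e : Nrν n a cE cVH cΛ cR cK cQ cΛ₂ ωgl TΛ μ m y u = ωgl * ((((n : ℝ) ^ 8)⁻¹ * (cΛ * (1 / 2 : ℝ))) *
      bubble (Ga n a) (SbfBal n a cE cVH 0 cR cK cQ μ u) (ffOf (hessFF n m y)) + (((n : ℝ) ^ 8)⁻¹ * (cΛ₂ * (1 / 2 : ℝ))) * tadpole (Ga n a) (TΛ m y μ u)) := by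
    simp only [Nrν, SbfBal_sub_SbL_eq]; ring
  rw [e]
  exact h m y u

/-- [folklore] **(D) FOR `Nrμ`**: `∃ C′, δ′ > 0, |Nrμ m y u| ≤ C′·e^{−δ′·|n•y − u|₁}`. -/
theorem Nrμ_decay (ha : 0 < a) (hGa : Spr (Ga n a)) (hδT : 0 < δT)
    (hTloc : ∀ m y κ u, BiLoc (TΛ m y κ u) ((n : ℤ) • y) ((n : ℤ) • y) (CT * Real.exp (-δT * l1 ((n : ℤ) • y - u))) δT) (ν : Fin 4) :
    ∃ C' δ' : ℝ, 0 < δ' ∧ ∀ (m : Fin 4) (y u : Site 4),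
      |Nrμ n a cE cVH cΛ cR cK cQ cΛ₂ ωgl TΛ ν m y u| ≤ C' * Real.exp (-δ' * l1 ((n : ℤ) • y - u)) := by
  obtain ⟨Cf, δf, hδf, hSf⟩ := exists_biLoc_SbfBal n a ha cE cVH cΛ cR cK cQ
  obtain ⟨KB, δB, hKB, hδB, -, hB⟩ := exists_bubble_Y_decay n hGa hδf hSf ν
  obtain ⟨KT, δT', hKT, hδT', hT⟩ := exists_tadpole_T_decay n hGa hδT hTloc ν
  obtain ⟨C', δ', hδ', h⟩ := decay_of_two n ωgl (((n : ℝ) ^ 8)⁻¹ * (cΛ * (1 / 2 : ℝ))) (((n : ℝ) ^ 8)⁻¹ * (cΛ₂ * (1 / 2 : ℝ)))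
    hKB hKT hδB hδT' (fun m y u => hB m y u) (fun m y u => hT m y u)
  refine ⟨C', δ', hδ', fun m y u => ?_⟩
  have e : Nrμ n a cE cVH cΛ cR cK cQ cΛ₂ ωgl TΛ ν m y u = ωgl * ((((n : ℝ) ^ 8)⁻¹ * (cΛ * (1 / 2 : ℝ))) *
      bubble (Ga n a) (ffOf (hessFF n m y)) (SbfBal n a cE cVH cΛ cR cK cQ ν u) + (((n : ℝ) ^ 8)⁻¹ * (cΛ₂ * (1 / 2 : ℝ))) * tadpole (Ga n a) (TΛ m y ν u)) := by
    simp only [Nrμ]; ring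
  rw [e]
  exact h m y u

end Letters

end Summit.QuantumFields.BalabanUV.Beta.D1BFx.LamPartnerLetters

end
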